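import Summits.ValiantsHypothesis.ValiantsHypothesis.Theorems.KPlusLogSqLawTropicalBActivationCycle

/-!
# Route «KPlusLogSqLaw», crux `TropicalB` (stmt-ValiantsHypothesis-19771) — ONE MULTI-RUN DOCKING OF SINGLE-TOKEN ACTIVATIONS IS IN DEFICIT

HONEST FRAMING.  Helper toward the registered stubs `stub_tropThin` / `stub_tropFat` of `Cruxes/TropicalB/Lines/birth.lean` (crux
`Summit.ValiantsHypothesis.ValiantsHypothesis.Theses.KPlusLogSqLaw.TropicalB`, item stmt-ValiantsHypothesis-19771, route KPlusLogSqLaw;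
cell `pub-symmetroid`, seat val-sym-trop-p5 g26, refuter-adjacent lane, 2026-08-29; `--supports … --as helper`).  A STRUCTURE law about
unique optima (`IsDominant`) of an ARBITRARY dominance design; nothing here bounds `TropicalB`, and nothing bears on `WeakLifting`,
DoorA26 / DoorA34, `MatrixDescartes` (stmt-ValiantsHypothesis-18050) or VP ≠ VNP.

THE LAW (`multiRun_deficit`, any finite index type `ι`).  `B` a unique optimum, `P j` (`j : ι`) single-token activations over `B` (token
columns `e j`); `A j` pairwise disjoint blocks of columns deviating in `P j` that DOCK in the sense of `Docking.docking` (…TropicalBDockingLaw: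
each block is a run of the exchange cycle of `P j` whose exit is followed by the terminal of the block `A (dock j)`), and for every `j` a
WITNESS column off `A j` at which `P j` deviates and differs from every `P k` whose block contains it.  Then the docked piece «`P j` on `A j`,
`B` elsewhere» is a present term other than `B` and all `P j`, its slope is `slope B + Σ_{j : e j ∈ A j} δ_j`, and the re-assembly deficit
(`Deficit.reassembly_deficit`, …TropicalBReassemblyDeficit) reads
`Σ_{j : e j ∈ A j} (V(P j) − V(B)) < Σ_j Σ_{i ∈ A j} (v(P j, i) − v(B, i))`.
This is the value engine of the free-polygon recombinations with the valuation side made EXPLICIT (a sum over the runs), so that two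
complementary dockings can be added run by run — used by the three-contact law (`…TropicalBThreeContact`); the one-piece case over `Bool` is
`piece_pos` of …TropicalBActivationCycle.  Compared with `FreePolygon.no_free_polygon` the non-degeneracy hypothesis is the weaker witness
form (a free triangle whose `P`-run is exactly a contact stretch has no column off all complementary runs, but it has a witness).

[this cell; folklore ingredients (exchange cycles, lower hulls)]
-/

set_option linter.dupNamespace false
set_option autoImplicit false

namespace Summit.ValiantsHypothesis.ValiantsHypothesis.Theorems.KPlusLogSqLaw

namespace SingleContact

/-! ## 7. One multi-run docking is in deficit (any finite index type) -/

section MultiRun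

open Summit.ValiantsHypothesis.ValiantsHypothesis.Theorems.MatrixDescartes.Negative
open Summit.ValiantsHypothesis.ValiantsHypothesis.Theorems.LacunarySymmetroidMatrixDescartes
open Finset

variable {m K : ℕ} {ι : Type*} [Fintype ι] [DecidableEq ι]
  (d : Fin K → ℕ) (v ε : Fin m → Fin m → Fin K → ℤ)

/-- **ONE MULTI-RUN DOCKING IS IN DEFICIT.**  `B` a unique optimum (at `θB`), `P j` (`j : ι`) single-token activations over `B` (token
columns `e j`, unique optima at `θ j`); `A j` pairwise disjoint blocks of columns deviating in `P j` that DOCK (`Docking.docking`: each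
`A j` is mapped into itself minus its terminal `t j` by `σ_B⁻¹σ_{P j}` except at its exit `x j`, whose image is the terminal of `A (dock j)`),
and for every `j` a WITNESS column off `A j` at which `P j` deviates and differs from every `P k` whose block contains it.  Then the piece
«`P j` on `A j` (all `j`), `B` elsewhere» is a present term other than `B` and every `P j`, and the re-assembly deficit reads:
`Σ_{j : e j ∈ A j} (V(P j) − V(B)) < Σ_j Σ_{i ∈ A j} (v(P j, i) − v(B, i))`. [this cell; folklore ingredients] -/
theorem multiRun_deficit [Nonempty ι] {θB : ℤ} (θ : ι → ℤ) {B : Equiv.Perm (Fin m) × (Fin m → Fin K)}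
    (P : ι → Equiv.Perm (Fin m) × (Fin m → Fin K))
    (hB : IsDominant d v ε θB B) (hP : ∀ j, IsDominant d v ε (θ j) (P j))
    (e : ι → Fin m) (hc : ∀ j i, i ≠ e j → d ((P j).2 i) = d (B.2 i)) (hδ : ∀ j, d (B.2 (e j)) < d ((P j).2 (e j)))
    (A : ι → Finset (Fin m)) (x t : ι → Fin m) (dock : ι ≃ ι)
    (hAA : ∀ j k, j ≠ k → Disjoint (A j) (A k)) (ht : ∀ j, t j ∈ A j)
    (hin : ∀ j, ∀ i ∈ A j, i ≠ x j → B.1.symm ((P j).1 i) ∈ A j ∧ B.1.symm ((P j).1 i) ≠ t j)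
    (hdock : ∀ j, B.1.symm ((P j).1 (x j)) = t (dock j))
    (hdev : ∀ j, ∀ i ∈ A j, ¬ ((P j).1 i = B.1 i ∧ (P j).2 i = B.2 i))
    (hwit : ∀ j, ∃ c, c ∉ A j ∧ ¬ ((P j).1 c = B.1 c ∧ (P j).2 c = B.2 c) ∧
      ∀ k, c ∈ A k → ¬ ((P k).1 c = (P j).1 c ∧ (P k).2 c = (P j).2 c)) :
    ∑ j ∈ univ.filter (fun j => e j ∈ A j), ((∑ i, v ((P j).1 i) i ((P j).2 i)) - ∑ i, v (B.1 i) i (B.2 i)) <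
      ∑ j, ∑ i ∈ A j, (v ((P j).1 i) i ((P j).2 i) - v (B.1 i) i (B.2 i)) := by
  classical
  obtain ⟨T, hTin, hTout⟩ := Docking.docking B P A x t dock hAA ht hin hdock
  have uA : ∀ {i : Fin m} {j k : ι}, i ∈ A j → i ∈ A k → j = k := by
    intro i j k hj hk; by_contra hne; exact disjoint_left.mp (hAA j k hne) hj hk
  -- presence and non-degeneracy
  have hTpres : termSign ε T ≠ 0 := by
    rw [termSign_ne_zero_iff]
    intro i
    by_cases hi : ∃ j, i ∈ A j
    · obtain ⟨j, hj⟩ := hi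
      rw [(hTin j i hj).1, (hTin j i hj).2]; exact (termSign_ne_zero_iff ε (P j)).1 (hP j).1 i
    · push Not at hi
      rw [(hTout i hi).1, (hTout i hi).2]; exact (termSign_ne_zero_iff ε B).1 hB.1 i
  have hTB : T ≠ B := by
    intro h
    obtain ⟨j⟩ := ‹Nonempty ι›
    exact hdev j (t j) (ht j) ⟨by rw [← (hTin j _ (ht j)).1, h], by rw [← (hTin j _ (ht j)).2, h]⟩
  have hTP : ∀ j, T ≠ P j := by
    intro j h
    obtain ⟨c, hcA, hcdev, hck⟩ := hwit j
    by_cases hi : ∃ k, c ∈ A k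
    · obtain ⟨k, hk⟩ := hi
      exact hck k hk ⟨by rw [← (hTin k c hk).1, h], by rw [← (hTin k c hk).2, h]⟩
    · push Not at hi
      exact hcdev ⟨by rw [← h, (hTout c hi).1], by rw [← h, (hTout c hi).2]⟩
  -- slope of the piece
  have slopeT : TropicalCensus.slope d T = TropicalCensus.slope d B +
      ∑ j ∈ univ.filter (fun j => e j ∈ A j), (TropicalCensus.slope d (P j) - TropicalCensus.slope d B) := by
    have key : ∀ i ∈ (univ : Finset (Fin m)), ((d (T.2 i)) : ℤ) = (d (B.2 i) : ℤ)
        + ∑ j, (if i = e j ∧ e j ∈ A j then ((d ((P j).2 (e j))) : ℤ) - d (B.2 (e j)) else 0) := by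
      intro i _
      by_cases hi : ∃ j, i ∈ A j
      · obtain ⟨j, hj⟩ := hi
        rw [(hTin j i hj).2]
        have hothers : ∀ k ∈ (univ : Finset ι), k ≠ j →
            (if i = e k ∧ e k ∈ A k then ((d ((P k).2 (e k))) : ℤ) - d (B.2 (e k)) else 0) = 0 := by
          intro k _ hkj
          rw [if_neg]
          rintro ⟨rfl, hk⟩
          exact hkj (uA hk hj)
        rw [← Finset.add_sum_erase _ _ (mem_univ j), Finset.sum_eq_zero (fun k hk => hothers k (mem_univ k) (ne_of_mem_erase hk)),
          add_zero]
        by_cases hie : i = e j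
        · subst hie; rw [if_pos ⟨rfl, hj⟩]; ring
        · rw [if_neg (fun h => hie h.1), hc j i hie]; ring
      · push Not at hi
        rw [(hTout i hi).2, Finset.sum_eq_zero]
        · ring
        · intro k _
          rw [if_neg]
          rintro ⟨rfl, hk⟩
          exact hi k hk
    have hsj : ∀ j, (∑ i, (d ((P j).2 i) : ℤ)) = (∑ i, (d (B.2 i) : ℤ)) + ((d ((P j).2 (e j)) : ℤ) - d (B.2 (e j))) := by
      intro j
      have := Docking.slope_eq_of_concentrated d B (P j) (e j) (hc j)
      unfold TropicalCensus.slope at this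
      exact this
    unfold TropicalCensus.slope
    rw [sum_congr rfl key, sum_add_distrib, sum_comm]
    congr 1
    rw [Finset.sum_filter]
    refine sum_congr rfl fun j _ => ?_
    rw [Finset.sum_ite, Finset.sum_const_zero, add_zero, Finset.sum_const, nsmul_eq_mul]
    by_cases h : e j ∈ A j
    · have : (univ.filter fun i => i = e j ∧ e j ∈ A j) = {e j} := by ext i; simp [h]
      rw [this, card_singleton, if_pos h, hsj j]
      push_cast; ring
    · have : (univ.filter fun i => i = e j ∧ e j ∈ A j) = ∅ := by ext i; simp [h]
      rw [this, card_empty, if_neg h]; simp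
  have hδ' : ∀ j, TropicalCensus.slope d B < TropicalCensus.slope d (P j) :=
    fun j => slope_lt_of_concentrated d (e j) (hc j) (hδ j)
  have key := Deficit.reassembly_deficit d v ε θ P hB hP hδ' hTpres hTB hTP _ slopeT
  -- valuation of the piece
  have rhs : (∑ i, v (T.1 i) i (T.2 i)) - ∑ i, v (B.1 i) i (B.2 i) =
      ∑ j, ∑ i ∈ A j, (v ((P j).1 i) i ((P j).2 i) - v (B.1 i) i (B.2 i)) := by
    rw [← sum_sub_distrib]
    have hpt : ∀ i ∈ (univ : Finset (Fin m)), v (T.1 i) i (T.2 i) - v (B.1 i) i (B.2 i) =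
        ∑ j, (if i ∈ A j then v ((P j).1 i) i ((P j).2 i) - v (B.1 i) i (B.2 i) else 0) := by
      intro i _
      by_cases hi : ∃ j, i ∈ A j
      · obtain ⟨j, hj⟩ := hi
        rw [(hTin j i hj).1, (hTin j i hj).2, ← Finset.add_sum_erase _ _ (mem_univ j), if_pos hj,
          Finset.sum_eq_zero, add_zero]
        intro k hk
        rw [if_neg]
        exact fun h => ne_of_mem_erase hk (uA h hj)
      · push Not at hi
        rw [(hTout i hi).1, (hTout i hi).2, Finset.sum_eq_zero]
        · ring
        · intro k _; rw [if_neg (hi k)]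
    rw [sum_congr rfl hpt, sum_comm]
    refine sum_congr rfl fun j _ => ?_
    rw [sum_ite_mem, univ_inter]
  rw [rhs] at key
  exact key

end MultiRun

end SingleContact

end Summit.ValiantsHypothesis.ValiantsHypothesis.Theorems.KPlusLogSqLaw
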